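import Summits.MatrixMultiplication.OmegaCensus.DominoZ19StructSixPairsC1
import Summits.MatrixMultiplication.OmegaCensus.DominoZ19StructSixPairsC2
import Summits.MatrixMultiplication.OmegaCensus.DominoZ19StructSixPairsC3
import Summits.MatrixMultiplication.OmegaCensus.DominoZ19StructSixPairsC4
import Summits.MatrixMultiplication.OmegaCensus.DominoZ19StructSixPairsC5
import Summits.MatrixMultiplication.OmegaCensus.DominoZ19StructSixPairsC6
import Summits.MatrixMultiplication.OmegaCensus.DominoZ19StructSixPairsC7
import Summits.MatrixMultiplication.OmegaCensus.DominoZ19StructSixPairsC8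
import Summits.MatrixMultiplication.OmegaCensus.DominoZ19StructSixPairsC9
import Summits.MatrixMultiplication.OmegaCensus.DominoZ19StructSixPairsC10
import Summits.MatrixMultiplication.OmegaCensus.DominoZ19StructSixPairsC11
import Summits.MatrixMultiplication.OmegaCensus.DominoZ19StructSixPairsC12
import Summits.MatrixMultiplication.OmegaCensus.DominoZ19StructSixPairsC13
import Summits.MatrixMultiplication.OmegaCensus.DominoZ19StructSixPairsC14
import HarnessLib

/-!
# The pair checks of family `c` (distinct directions) for the structural part-`6` route, `p = 19`: assembly

ω-census `pub-omega`, family (b3), seat pub-omega-group gen 25.  Framing: lottery ticket; floor = certified bounds/negative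
ranges.  VALUE: per-prime kernel data of the structural part-`6` route WITHOUT the pigeonhole (`DominoZpZpStructSixWide*.lean`)
for `p = 19` — target: the OPEN census cell `(1,6,20)@361` (`A = ℤ₁₉²`) and every larger order with such a quotient; NOT progress on ω.

`checkH6c_19` = hypothesis `h3c` of `exists_goodS_wide` from the 64 per-representative decides of the part files.
-/

namespace Summit.MatrixMultiplication.OmegaCensus

open ZpZpDomino

namespace ZpZpDomino

/-- **The pair check of family `c` over all representatives.** [folklore] -/
theorem checkH6c_19 : ∀ k ∈ rZ19s6, checkH6c 19 etZ19s6 yscZ19s6 k = true := by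
  simp only [rZ19s6, List.forall_mem_cons]
  exact ⟨checkH6c_19_0, checkH6c_19_1, checkH6c_19_2, checkH6c_19_3, checkH6c_19_4, checkH6c_19_5, checkH6c_19_6, checkH6c_19_7, checkH6c_19_8, checkH6c_19_9, checkH6c_19_10, checkH6c_19_11, checkH6c_19_12, checkH6c_19_13, checkH6c_19_14, checkH6c_19_15, checkH6c_19_16, checkH6c_19_17, checkH6c_19_18, checkH6c_19_19, checkH6c_19_20, checkH6c_19_21, checkH6c_19_22, checkH6c_19_23, checkH6c_19_24, checkH6c_19_25, checkH6c_19_26, checkH6c_19_27, checkH6c_19_28, checkH6c_19_29, checkH6c_19_30, checkH6c_19_31, checkH6c_19_32, checkH6c_19_33, checkH6c_19_34, checkH6c_19_35, checkH6c_19_36, checkH6c_19_37, checkH6c_19_38, checkH6c_19_39, checkH6c_19_40, checkH6c_19_41, checkH6c_19_42, checkH6c_19_43, checkH6c_19_44, checkH6c_19_45, checkH6c_19_46, checkH6c_19_47, checkH6c_19_48, checkH6c_19_49, checkH6c_19_50, checkH6c_19_51, checkH6c_19_52, checkH6c_19_53, checkH6c_19_54, checkH6c_19_55, checkH6c_19_56,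 checkH6c_19_57, checkH6c_19_58, checkH6c_19_59, checkH6c_19_60, checkH6c_19_61, checkH6c_19_62, checkH6c_19_63, fun _ h => (List.not_mem_nil h).elim⟩

end ZpZpDomino

end Summit.MatrixMultiplication.OmegaCensus
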